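import Summits.CriticalPhenomena.PercolationContinuityZ3.Theorems.PercNearOneGluingNoHeavyLowerTailSahiStrongCubicMax
import Summits.CriticalPhenomena.PercolationContinuityZ3.Theorems.SahiMasterFamilyEqPrincipal
import Mathlib.Tactic.Linarith
import Mathlib.Tactic.Ring
import HarnessLib

/-!
# `NoHeavyLowerTail` (crux stmt-CriticalPhenomena-4575), master-family line P1 (gen 26):
# RAINBOW JOINS AND MEETS — the refined one-payer conjecture `e₃ ≤ max(o, μ(J))·(κo − e₂)` (⟹ S₃^max), typed, with its kernel links

Support file (seat `prim-masterthm-p1`, gen 26; `--supports stmt-CriticalPhenomena-4575`).  Four definitions (`rainbowJoins`,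
`rainbowMeets`, `strongCubicJoin`, `strongCubicMeet`), two typed conjectures, no `sorry`, standard axioms.  Memo
`run/shared/lean/prim/prim-masterthm/FROM-prim-masterthm-p1-g26-RAINBOW-JOINS.md` §0–§3.

SETTING (tree `SahiDeepCore`, files `…SahiStrongCubicPlus`, `…SahiStrongCubicMax`): a sandwiched triple `(A,B,N)` of up-sets
(`A∖B ⊆ N`, `B∖A ⊆ N`, `N ⊆ A∪B`) has petals `A∖B, B∖A, (A∩B)∖N` (masses `α, β, d`), core `K = A∩B∩N` (`κ`), outside
`O = (A∪B)ᶜ` (`o`); `e₂ = αβ+αd+βd`, `e₃ = αβd`, `G = κo − e₂ ≥ 0` (`gladkovDefect`, Gladkov); S₃^max is `e₃ ≤ max(κ,o)·G`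
(`StrongCubicMaxNonneg`, open).  A RAINBOW is a triple `(x,y,z)` with one configuration in each petal; its JOIN `x ∪ y ∪ z`
lies in the core and its MEET `x ∩ y ∩ z` in the outside (`rainbowJoins_subset_core`, `rainbowMeets_subset_outside`) — these are
the first and last Aharoni–Keich order statistics of the rainbow.

NEW HERE (gen 26, all [this work]).
* `rainbowJoins A B N = {x ∪ y ∪ z}` (`J ⊆ K`), `rainbowMeets A B N = {x ∩ y ∩ z}` (`M ⊆ O`), and the REFINED one-payer functionals
  `strongCubicJoin := max(o, μ(J))·G − e₃`, `strongCubicMeet := max(κ, μ(M))·G − e₃`; both are `≤ strongCubicMax`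
  (`strongCubicJoin_le_strongCubicMax`, `strongCubicMeet_le_strongCubicMax`), so each of the typed conjectures
  `StrongCubicJoinNonneg p` / `StrongCubicMeetNonneg p` IMPLIES S₃^max (`strongCubicMaxNonneg_of_join`, `…_of_meet`), hence S₃⁺,
  S₃ and the co-sunflower class law.  Dichotomy reading (`strongCubicJoin_nonneg_iff`): **the outside pays for all rainbows
  (`e₃ ≤ o·G`) or the rainbow JOINS alone pay (`e₃ ≤ μ(J)·G`)**; dually the core pays or the rainbow MEETS pay.  The two conjectures
  are exchanged by the duality `(K,O,≤) ↦ (O,K,≥)` of `M₃`-systems, which maps joins to meets.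
* CENSUS (this gen; exact enumeration of all `M₃`-systems = sandwiched triples, floating masses, `work/c/exh5.c`, `tri.c`):
  BOTH conjectures have 0 failures on all 2 022 systems of `2^4` × `7^4` heterogeneous bias vectors, on ALL 21 121 450 systems of `2^5`
  × 27 bias vectors (5.7·10⁸ evaluations), on ≈ 3·10⁶ random systems on 6–10 coordinates with heterogeneous biases, and on 1.4·10⁵
  perturbations of the two equality families; the ratio `e₃ / (max(o,μJ)·G)` reaches `1` only on dressings of std3 (where `J = K`,
  equality of the core branch) and of dual-std3 (where `e₃ = o·G`).  The over-strong variants `e₃ ≤ max(μJ, μM)·G`,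
  `e₃ ≤ max(μJ, μ(O ∩ ↓M))·G` are FALSE already on `2^4`.  COMB LEVEL (kit j232972, exact LP): the switch-factored certificate
  (SPLIT) of gen 23 can be chosen with kernel shifts ONLY at rainbow joins (`ê₃ ≼ Ô·P + Ĵ·Q`, `P+Q = G`, `P,Q ≽ 0`) on all
  4 044 = 2·2 022 systems/duals of `2^4` and 2 400 random systems of `2^5` (all integral) — the comb shadow of `StrongCubicJoinNonneg`.
* For comparison, the Aharoni–Keich inequality gives the HYPOTHESIS-FREE bound `e₃ ≤ μ(J)·μ(M)` (sorting `(x,y,z) ↦ (x∪y∪z, Maj, x∩y∩z)`;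
  [AharoniKeich1996]; not formalised here); the conjecture replaces one factor by Gladkov's second-order defect `G`.
* A small unconditional lemma in the same circle of ideas (`core_sq_ge_harris`): `μ(A)μ(B)·μ(A∩N)μ(B∩N) ≤ κ²` (Harris twice), i.e. the
  defect of the CORE branch `μ(A∩N)μ(B∩N)μ(A∩B) ≤ κ²` is at most the Harris excess `μ(A∩B)/(μ(A)μ(B))` of the generating pair.
HONEST FRAMING: typed conjectures + reductions + one elementary lemma; `StrongCubicJoinNonneg`, S₃^max, S₃⁺, S₃ remain OPEN. [this work]
-/

noncomputable section

open scoped Classical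

namespace Summit.CriticalPhenomena.PercolationContinuityZ3.Theorems

namespace SahiDeepCore

open Literature.Combinatorics.Sahi2008
open Literature.Probability.Percolation (DeterminedBy determinedBy_iff)
open Literature.Probability.Percolation.DecisionTree (ind ind_of_mem ind_of_not_mem ind_nonneg)

variable {ι : Type} [Fintype ι]

local notation3 (prettyPrint := false) "m⟦" p ", " X "⟧" => ex (bernoulliWeight p) (ind X)

/-! ### 1. Rainbow joins and meets -/

omit [Fintype ι] in
/-- **Rainbow joins**: the unions `x ∪ y ∪ z` of one configuration from each petal `A∖B`, `B∖A`, `(A∩B)∖N`. [this work] -/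
def rainbowJoins (A B N : Set (Set ι)) : Set (Set ι) :=
  {ω | ∃ x ∈ A \ B, ∃ y ∈ B \ A, ∃ z ∈ (A ∩ B) \ N, ω = x ∪ y ∪ z}

omit [Fintype ι] in
/-- **Rainbow meets**: the intersections `x ∩ y ∩ z` of one configuration from each petal. [this work] -/
def rainbowMeets (A B N : Set (Set ι)) : Set (Set ι) :=
  {ω | ∃ x ∈ A \ B, ∃ y ∈ B \ A, ∃ z ∈ (A ∩ B) \ N, ω = x ∩ y ∩ z}

omit [Fintype ι] in
/-- **Rainbow joins lie in the core** `A ∩ B ∩ N` (for up-sets with `A∖B ⊆ N`). [this work] -/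
theorem rainbowJoins_subset_core {A B N : Set (Set ι)} (hA : IsUpperSet A) (hB : IsUpperSet B) (hN : IsUpperSet N)
    (hAB : A \ B ⊆ N) : rainbowJoins A B N ⊆ A ∩ B ∩ N := by
  rintro ω ⟨x, hx, y, hy, z, _, rfl⟩
  have hxle : x ≤ x ∪ y ∪ z := fun i hi => Or.inl (Or.inl hi)
  have hyle : y ≤ x ∪ y ∪ z := fun i hi => Or.inl (Or.inr hi)
  exact ⟨⟨hA hxle hx.1, hB hyle hy.1⟩, hN hxle (hAB hx)⟩

omit [Fintype ι] in
/-- **Rainbow meets lie in the outside** `(A ∪ B)ᶜ` (for up-sets `A, B`). [this work] -/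
theorem rainbowMeets_subset_outside {A B N : Set (Set ι)} (hA : IsUpperSet A) (hB : IsUpperSet B) :
    rainbowMeets A B N ⊆ (A ∪ B)ᶜ := by
  rintro ω ⟨x, hx, y, hy, z, _, rfl⟩
  have hley : x ∩ y ∩ z ≤ y := fun i hi => hi.1.2
  have hlex : x ∩ y ∩ z ≤ x := fun i hi => hi.1.1
  rintro (h | h)
  · exact hy.2 (hA hley h)
  · exact hx.2 (hB hlex h)

/-! ### 2. Small measure lemmas -/

/-- Monotonicity of `μ_p` under inclusion. [folklore] -/
private theorem m_le_of_subset (p : ι → unitInterval) {X Y : Set (Set ι)} (h : X ⊆ Y) : m⟦p, X⟧ ≤ m⟦p, Y⟧ :=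
  ex_mono (isFKGMeasure_bernoulliWeight p).nonneg fun ω => by
    by_cases hx : ω ∈ X
    · rw [ind_of_mem hx, ind_of_mem (h hx)]
    · rw [ind_of_not_mem hx]; exact ind_nonneg _ _

/-- `0 ≤ μ_p(X)`. [folklore] -/
private theorem m_nonneg (p : ι → unitInterval) (X : Set (Set ι)) : 0 ≤ m⟦p, X⟧ :=
  ex_nonneg (isFKGMeasure_bernoulliWeight p).nonneg fun ω => ind_nonneg _ ω

/-! ### 3. The refined one-payer functionals and their comparison with `strongCubicMax` -/

/-- **The join-side functional** `max(o, μ(J))·(κo − e₂) − e₃`: the outside or the rainbow joins pay. [this work] -/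
def strongCubicJoin (p : ι → unitInterval) (A B N : Set (Set ι)) : ℝ :=
  max (m⟦p, (A ∪ B)ᶜ⟧) (m⟦p, rainbowJoins A B N⟧) * gladkovDefect p A B N
    - m⟦p, A \ B⟧ * m⟦p, B \ A⟧ * m⟦p, (A ∩ B) \ N⟧

/-- **The meet-side functional** `max(κ, μ(M))·(κo − e₂) − e₃`: the core or the rainbow meets pay (dual of `strongCubicJoin`). [this work] -/
def strongCubicMeet (p : ι → unitInterval) (A B N : Set (Set ι)) : ℝ :=
  max (m⟦p, A ∩ B ∩ N⟧) (m⟦p, rainbowMeets A B N⟧) * gladkovDefect p A B N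
    - m⟦p, A \ B⟧ * m⟦p, B \ A⟧ * m⟦p, (A ∩ B) \ N⟧

/-- **`strongCubicJoin ≤ strongCubicMax`**: `μ(J) ≤ κ` because `J ⊆ K`, and `G ≥ 0`. [this work] -/
theorem strongCubicJoin_le_strongCubicMax (p : ι → unitInterval) {A B N : Set (Set ι)} (hA : IsUpperSet A)
    (hB : IsUpperSet B) (hNup : IsUpperSet N) (hAB : A \ B ⊆ N) (hBA : B \ A ⊆ N) (hN : N ⊆ A ∪ B) :
    strongCubicJoin p A B N ≤ strongCubicMax p A B N := by
  have hG := gladkovDefect_nonneg p hA hB hNup hAB hBA hN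
  have hJ : m⟦p, rainbowJoins A B N⟧ ≤ m⟦p, A ∩ B ∩ N⟧ := m_le_of_subset p (rainbowJoins_subset_core hA hB hNup hAB)
  have hmax : max (m⟦p, (A ∪ B)ᶜ⟧) (m⟦p, rainbowJoins A B N⟧) ≤ max (m⟦p, A ∩ B ∩ N⟧) (m⟦p, (A ∪ B)ᶜ⟧) :=
    max_le (le_max_right _ _) (le_trans hJ (le_max_left _ _))
  have := mul_le_mul_of_nonneg_right hmax hG
  simp only [strongCubicJoin, strongCubicMax]
  linarith

/-- **`strongCubicMeet ≤ strongCubicMax`**: `μ(M) ≤ o` because `M ⊆ O`, and `G ≥ 0`. [this work] -/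
theorem strongCubicMeet_le_strongCubicMax (p : ι → unitInterval) {A B N : Set (Set ι)} (hA : IsUpperSet A)
    (hB : IsUpperSet B) (hNup : IsUpperSet N) (hAB : A \ B ⊆ N) (hBA : B \ A ⊆ N) (hN : N ⊆ A ∪ B) :
    strongCubicMeet p A B N ≤ strongCubicMax p A B N := by
  have hG := gladkovDefect_nonneg p hA hB hNup hAB hBA hN
  have hM : m⟦p, rainbowMeets A B N⟧ ≤ m⟦p, (A ∪ B)ᶜ⟧ := m_le_of_subset p (rainbowMeets_subset_outside hA hB)
  have hmax : max (m⟦p, A ∩ B ∩ N⟧) (m⟦p, rainbowMeets A B N⟧) ≤ max (m⟦p, A ∩ B ∩ N⟧) (m⟦p, (A ∪ B)ᶜ⟧) :=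
    max_le (le_max_left _ _) (le_trans hM (le_max_right _ _))
  have := mul_le_mul_of_nonneg_right hmax hG
  simp only [strongCubicMeet, strongCubicMax]
  linarith

/-- **Refined one-payer dichotomy (join side).**  When `G ≥ 0`: `0 ≤ strongCubicJoin` iff the OUTSIDE pays for all rainbows
(`e₃ ≤ o·G`) or the rainbow JOINS do (`e₃ ≤ μ(J)·G`). [this work] -/
theorem strongCubicJoin_nonneg_iff (p : ι → unitInterval) {A B N : Set (Set ι)} (hG : 0 ≤ gladkovDefect p A B N) :
    0 ≤ strongCubicJoin p A B N ↔
      m⟦p, A \ B⟧ * m⟦p, B \ A⟧ * m⟦p, (A ∩ B) \ N⟧ ≤ m⟦p, (A ∪ B)ᶜ⟧ * gladkovDefect p A B N ∨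
        m⟦p, A \ B⟧ * m⟦p, B \ A⟧ * m⟦p, (A ∩ B) \ N⟧ ≤ m⟦p, rainbowJoins A B N⟧ * gladkovDefect p A B N := by
  simp only [strongCubicJoin, sub_nonneg, max_mul_of_nonneg _ _ hG, le_max_iff]

/-- **Refined one-payer dichotomy (meet side).**  When `G ≥ 0`: `0 ≤ strongCubicMeet` iff the CORE pays (`e₃ ≤ κ·G`) or the
rainbow MEETS do (`e₃ ≤ μ(M)·G`). [this work] -/
theorem strongCubicMeet_nonneg_iff (p : ι → unitInterval) {A B N : Set (Set ι)} (hG : 0 ≤ gladkovDefect p A B N) :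
    0 ≤ strongCubicMeet p A B N ↔
      m⟦p, A \ B⟧ * m⟦p, B \ A⟧ * m⟦p, (A ∩ B) \ N⟧ ≤ m⟦p, A ∩ B ∩ N⟧ * gladkovDefect p A B N ∨
        m⟦p, A \ B⟧ * m⟦p, B \ A⟧ * m⟦p, (A ∩ B) \ N⟧ ≤ m⟦p, rainbowMeets A B N⟧ * gladkovDefect p A B N := by
  simp only [strongCubicMeet, sub_nonneg, max_mul_of_nonneg _ _ hG, le_max_iff]

/-! ### 4. The typed conjectures and the kernel links to S₃^max -/

/-- **CONJECTURE (rainbow-join one-payer inequality; typed).**  For every sandwiched increasing triple determined by a finite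
coordinate set: `e₃ ≤ max(o, μ(J))·(κo − e₂)` where `J` is the set of rainbow joins.  Sharper than S₃^max (`μ(J) ≤ κ`); 0 failures
in the exhaustive census on ≤ 5 coordinates and the random census on 6–10 coordinates (file header); tight exactly on the dressings
of std3 (`J = K`) and of dual-std3 (`e₃ = o·G`). [this work] [status: open] -/
@[conjecture] def StrongCubicJoinNonneg (p : ι → unitInterval) : Prop :=
  ∀ (S : Finset ι) (A B N : Set (Set ι)), IsUpperSet A → IsUpperSet B → IsUpperSet N →
    A \ B ⊆ N → B \ A ⊆ N → N ⊆ A ∪ B →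
    DeterminedBy A (↑S : Set ι) → DeterminedBy B (↑S : Set ι) → DeterminedBy N (↑S : Set ι) →
    0 ≤ strongCubicJoin p A B N

/-- **CONJECTURE (rainbow-meet one-payer inequality; typed)** — the dual statement `e₃ ≤ max(κ, μ(M))·(κo − e₂)`, `M` the set of
rainbow meets.  Same census status. [this work] [status: open] -/
@[conjecture] def StrongCubicMeetNonneg (p : ι → unitInterval) : Prop :=
  ∀ (S : Finset ι) (A B N : Set (Set ι)), IsUpperSet A → IsUpperSet B → IsUpperSet N →
    A \ B ⊆ N → B \ A ⊆ N → N ⊆ A ∪ B →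
    DeterminedBy A (↑S : Set ι) → DeterminedBy B (↑S : Set ι) → DeterminedBy N (↑S : Set ι) →
    0 ≤ strongCubicMeet p A B N

/-- **The join conjecture implies S₃^max** (hence S₃⁺, S₃ and the class law, by `…SahiStrongCubicMax`). [this work] -/
theorem strongCubicMaxNonneg_of_join (p : ι → unitInterval) (h : StrongCubicJoinNonneg p) : StrongCubicMaxNonneg p :=
  fun S A B N hA hB hN hAB hBA hNs dA dB dN =>
    le_trans (h S A B N hA hB hN hAB hBA hNs dA dB dN) (strongCubicJoin_le_strongCubicMax p hA hB hN hAB hBA hNs)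

/-- **The meet conjecture implies S₃^max.** [this work] -/
theorem strongCubicMaxNonneg_of_meet (p : ι → unitInterval) (h : StrongCubicMeetNonneg p) : StrongCubicMaxNonneg p :=
  fun S A B N hA hB hN hAB hBA hNs dA dB dN =>
    le_trans (h S A B N hA hB hN hAB hBA hNs dA dB dN) (strongCubicMeet_le_strongCubicMax p hA hB hN hAB hBA hNs)

/-! ### 5. The core-branch defect is controlled by the Harris excess of the generating pair -/

omit [Fintype ι] in
/-- `1_{A∩N} = 1_{A∖B} + 1_{A∩B∩N}` pointwise when `A∖B ⊆ N`. [this work] -/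
private theorem ind_inter_third {A B N : Set (Set ι)} (hAB : A \ B ⊆ N) :
    ind (A ∩ N) = ind (A \ B) + ind (A ∩ B ∩ N) := by
  funext ω
  simp only [Pi.add_apply]
  by_cases ha : ω ∈ A
  · by_cases hb : ω ∈ B
    · rw [ind_of_not_mem (show ω ∉ A \ B from fun h => h.2 hb)]
      by_cases hn : ω ∈ N
      · rw [ind_of_mem (show ω ∈ A ∩ N from ⟨ha, hn⟩), ind_of_mem (show ω ∈ A ∩ B ∩ N from ⟨⟨ha, hb⟩, hn⟩)]; norm_num
      · rw [ind_of_not_mem (show ω ∉ A ∩ N from fun h => hn h.2),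
          ind_of_not_mem (show ω ∉ A ∩ B ∩ N from fun h => hn h.2)]; norm_num
    · rw [ind_of_mem (show ω ∈ A \ B from ⟨ha, hb⟩), ind_of_mem (show ω ∈ A ∩ N from ⟨ha, hAB ⟨ha, hb⟩⟩),
        ind_of_not_mem (show ω ∉ A ∩ B ∩ N from fun h => hb h.1.2)]; norm_num
  · rw [ind_of_not_mem (show ω ∉ A ∩ N from fun h => ha h.1), ind_of_not_mem (show ω ∉ A \ B from fun h => ha h.1),
      ind_of_not_mem (show ω ∉ A ∩ B ∩ N from fun h => ha h.1.1)]; norm_num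

/-- `μ(A∩N) = α + κ` for a sandwiched triple. [this work] -/
theorem mass_inter_third (p : ι → unitInterval) {A B N : Set (Set ι)} (hAB : A \ B ⊆ N) :
    m⟦p, A ∩ N⟧ = m⟦p, A \ B⟧ + m⟦p, A ∩ B ∩ N⟧ := by
  have h := congrArg (ex (bernoulliWeight p)) (ind_inter_third hAB)
  rwa [ex_add] at h

/-- **Harris twice**: `μ(A)·μ(B∩N) ≤ κ` and `μ(B)·μ(A∩N) ≤ κ` for increasing `A, B, N`, hence
`μ(A)μ(B)·μ(A∩N)μ(B∩N) ≤ κ²`. [this work] -/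
theorem core_sq_ge_harris (p : ι → unitInterval) {A B N : Set (Set ι)} (hA : IsUpperSet A) (hB : IsUpperSet B)
    (hN : IsUpperSet N) :
    m⟦p, A⟧ * m⟦p, B⟧ * (m⟦p, A ∩ N⟧ * m⟦p, B ∩ N⟧) ≤ m⟦p, A ∩ B ∩ N⟧ ^ 2 := by
  have h1 := harris_ex_ind p hA (hB.inter hN)
  have h2 := harris_ex_ind p hB (hA.inter hN)
  have e1 : A ∩ (B ∩ N) = A ∩ B ∩ N := (Set.inter_assoc A B N).symm
  have e2 : B ∩ (A ∩ N) = A ∩ B ∩ N := by rw [← Set.inter_assoc, Set.inter_comm B A]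
  rw [e1] at h1
  rw [e2] at h2
  have hAn := m_nonneg p A
  have hBn := m_nonneg p B
  have hANn := m_nonneg p (A ∩ N)
  have hBNn := m_nonneg p (B ∩ N)
  have hκ := m_nonneg p (A ∩ B ∩ N)
  calc m⟦p, A⟧ * m⟦p, B⟧ * (m⟦p, A ∩ N⟧ * m⟦p, B ∩ N⟧)
      = (m⟦p, A⟧ * m⟦p, B ∩ N⟧) * (m⟦p, B⟧ * m⟦p, A ∩ N⟧) := by ring
    _ ≤ m⟦p, A ∩ B ∩ N⟧ * m⟦p, A ∩ B ∩ N⟧ :=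
        mul_le_mul h1 h2 (mul_nonneg hBn hANn) hκ
    _ = m⟦p, A ∩ B ∩ N⟧ ^ 2 := by ring

/-- **The core branch, up to the Harris excess of `(A, B)`**: in cells, `(κ+α)(κ+β)·μ(A)μ(B) ≤ κ²`; since the core branch of
S₃^max reads `(κ+α)(κ+β)(κ+d) ≤ κ²` (`μ(A∩B) = κ+d`), its possible defect is at most the factor `μ(A∩B)/(μ(A)μ(B)) ≥ 1`
(Harris).  In particular **the core pays whenever `μ(A∩B) = μ(A)μ(B)`**. [this work] -/
theorem corePays_of_uncorrelated (p : ι → unitInterval) {A B N : Set (Set ι)} (hA : IsUpperSet A) (hB : IsUpperSet B)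
    (hN : IsUpperSet N) (hAB : A \ B ⊆ N) (hBA : B \ A ⊆ N) (hNs : N ⊆ A ∪ B)
    (hind : m⟦p, A ∩ B⟧ = m⟦p, A⟧ * m⟦p, B⟧) :
    m⟦p, A \ B⟧ * m⟦p, B \ A⟧ * m⟦p, (A ∩ B) \ N⟧ ≤ m⟦p, A ∩ B ∩ N⟧ * gladkovDefect p A B N := by
  have hsq := core_sq_ge_harris p hA hB hN
  rw [← hind] at hsq
  have hAN := mass_inter_third p hAB
  have hN' : N ⊆ B ∪ A := fun ω h => (hNs h).symm
  have hBN : m⟦p, B ∩ N⟧ = m⟦p, B \ A⟧ + m⟦p, A ∩ B ∩ N⟧ := by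
    have h := mass_inter_third p (A := B) (B := A) (N := N) hBA
    rw [show B ∩ A ∩ N = A ∩ B ∩ N by rw [Set.inter_comm B A]] at h
    exact h
  obtain ⟨_, hT⟩ := cells_of_sandwich p hAB hNs
  have hsum := cells_sum_eq_one p A B N
  have ho : m⟦p, (A ∪ B)ᶜ⟧ = 1 - (m⟦p, A \ B⟧ + m⟦p, B \ A⟧ + m⟦p, A ∩ B ∩ N⟧ + m⟦p, (A ∩ B) \ N⟧) := by linarith
  rw [hAN, hBN, hT] at hsq
  have key : m⟦p, A ∩ B ∩ N⟧ * gladkovDefect p A B N - m⟦p, A \ B⟧ * m⟦p, B \ A⟧ * m⟦p, (A ∩ B) \ N⟧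
      = m⟦p, A ∩ B ∩ N⟧ ^ 2
        - (m⟦p, A ∩ B ∩ N⟧ + m⟦p, (A ∩ B) \ N⟧)
          * ((m⟦p, A \ B⟧ + m⟦p, A ∩ B ∩ N⟧) * (m⟦p, B \ A⟧ + m⟦p, A ∩ B ∩ N⟧)) := by
    simp only [gladkovDefect]; rw [ho]; ring
  linarith

/-- **S₃^max on the uncorrelated-pair locus**: if `μ(A∩B) = μ(A)μ(B)` then `0 ≤ strongCubicMax p A B N` (the core pays).
[this work] -/
theorem strongCubicMax_nonneg_of_uncorrelated (p : ι → unitInterval) {A B N : Set (Set ι)} (hA : IsUpperSet A)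
    (hB : IsUpperSet B) (hN : IsUpperSet N) (hAB : A \ B ⊆ N) (hBA : B \ A ⊆ N) (hNs : N ⊆ A ∪ B)
    (hind : m⟦p, A ∩ B⟧ = m⟦p, A⟧ * m⟦p, B⟧) : 0 ≤ strongCubicMax p A B N :=
  (strongCubicMax_nonneg_iff p (gladkovDefect_nonneg p hA hB hN hAB hBA hNs)).2
    (Or.inl (corePays_of_uncorrelated p hA hB hN hAB hBA hNs hind))

end SahiDeepCore

end Summit.CriticalPhenomena.PercolationContinuityZ3.Theorems
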